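/-
Copyright (c) 2026. All rights reserved.
Released under Apache 2.0 license as described in the file LICENSE.
Authors: abc-iut cell, fact-proving seat abc-iut-f-102 (block F, tranche 102, gen 2).
-/
import Literature.AnabelianGeometry.AbsoluteAnabelian.LogFrobeniusCoresProofs
import Literature.AnabelianGeometry.AbsoluteAnabelian.LogFrobeniusShiftInvariantPart
import HarnessLib

/-!
# [AbsTopIII] Corollary 5.5 (iii)/(v): the post-log pair of `S_log⊞_v` inside one family is a SHIFT-INVARIANT pair

S. Mochizuki, *Topics in absolute anabelian geometry III: global reconstruction algorithms*,
J. Math. Sci. Univ. Tokyo 22 (2015) 939–1156 [MochizukiAbsTopIII2015]; locators `p.N` = pages of the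
author's manuscript (`paper:url-5493eb38cbb7`): Def 3.5 (ii) p. 75, Def 5.4 (iii), (v), (vii) pp. 126–128 (the graphs
`Γ⃗^log_v`, the post-log vertex, `ι⊞_{v,ε}`), Cor 5.5 (iii) p. 131, (v) pp. 131–133.

PROOF-ONLY companion of `LogFrobeniusShiftInvariantPart.lean` (this seat: the saturated set `ShiftInvariantE K` of
shift-invariant pairs of a family `K` on `D•⊢`), step 1 of THEOREM A (F-0157 ⟺ `∃ K`, F-0159).  For EVERY setting `L`, every
family `K` on `D•⊢` carrying the observable `S_log⊞_v` of Cor 5.5 (iii) (`IsLogObservablePlus` embedded by `CompatibleIn`) and an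
arrow `ε` of `Γ⃗^⋉_v` out of the post-log vertex (one always exists, `LogVertex.exists_postLog_edge`):
* `exists_η_postLogPair_eq_iota`: at every `⋎ = n` the post-log pair `([λ⊞_{v,sl}]∘[id_n]∘[log], [λ⊞_{v,ν₂}]∘[id_{n+1}])` of
  paths `𝒳_{n+1} → 𝒩⊞_v` (third clause of the typed (iii)) is a boundary pair of `K` with homotopy `ι⊞_{v,ε}` componentwise;
* `shiftInvariantE_postLogPair`: hence it is a SHIFT-INVARIANT pair of `K` — its shifts are the post-log pairs at the other
  `⋎` (`mapPath_shift_postLogDom_heq`, `mapPath_shift_postLogCod_heq`), all pinned to the same `ι⊞_{v,ε}`.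
This is the one homotopy between a `log`-first and an `id_⋎`-first path that the observable PINS inside a realising family;
the sequel `LogFrobeniusShiftActionPinning.lean` propagates it to every pair of paths into a core vertex.  Refereed pre-IUT
material; nothing here bears on [IUTchIII] Cor. 3.12; typed ≠ proved.
-/

set_option autoImplicit false

universe v u w

open CategoryTheory Quiver

namespace Literature.AnabelianGeometry.AbsoluteAnabelian

/-- Paths with equal tails and heterogeneously equal heads agree. [cite: MochizukiAbsTopIII2015, Section 0 p.26] -/
theorem Quiver.Path.toPath_comp_heq {V : Type w} [Quiver.{v} V] {a a' b c : V} (ha : a = a') {e : a ⟶ b} {e' : a' ⟶ b}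
    (he : HEq e e') (p : Path b c) : HEq (e.toPath.comp p) (e'.toPath.comp p) := by
  subst ha; cases he; rfl

/-- Components along equalities of the source and target functors differ by `eqToHom`s. [folklore] -/
private theorem app_eq_of_heq {A B : Type*} [Category A] [Category B] {F G F' G' : A ⥤ B} (hF : F = F') (hG : G = G')
    {α : F ⟶ G} {β : F' ⟶ G'} (h : HEq α β) (x : A) :
    β.app x = eqToHom (by rw [hF]) ≫ α.app x ≫ eqToHom (by rw [hG]) := by
  subst hF hG
  cases h
  simp

namespace LogFrobeniusSetting

open DiagramOfCategories

variable {Vmod : Type u} {isArc : Vmod → Bool} {L : LogFrobeniusSetting Vmod isArc}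

/-! ## The post-log pair of `S_log⊞_{v}` inside `K`: homotopy `ι⊞_{v,ε}` at every `⋎` -/

/-- Every `Γ⃗^⋉_v` has an arrow `k~ →(id) k~` out of the post-log vertex into a PRE-LOG vertex (the pre-log `k~`, resp. the
shell-codomain `k~`). [cite: MochizukiAbsTopIII2015, Def 5.4 (iii) p. 126] -/
theorem _root_.Literature.AnabelianGeometry.AbsoluteAnabelian.LogVertex.exists_postLog_edge (b : Bool) :
    ∃ (ν₂ : LogVertex b) (_ : LogEdge b (LogVertex.postLog b) ν₂), ν₂.isPostLog = false := by
  cases b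
  · exact ⟨NonarchVertex.shellCod, ⟨NonarchEdge.postLogId, trivial⟩, rfl⟩
  · exact ⟨ArchVertex.pre, ArchEdge.postLogId, rfl⟩

/-- **The post-log pair of the observable inside `K`.**  If `K` carries `S_log⊞_v` (`IsLogObservablePlus` embedded by
`CompatibleIn`), then for an arrow `ε` of `Γ⃗^⋉_v` out of the post-log vertex into a pre-log `ν₂` and every `⋎ = n`, the
pair `([λ⊞_{v,sl}]∘[id_n]∘[log], [λ⊞_{v,ν₂}]∘[id_{n+1}])` of paths `𝒳_{n+1} → 𝒩⊞_v` is a boundary pair of `K` whose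
homotopy is `ι⊞_{v,ε}` componentwise (third clause of the typed (iii)). [cite: MochizukiAbsTopIII2015, Cor 5.5 (iii) p. 131] -/
theorem exists_η_postLogPair_eq_iota {K : L.diagram.HomotopyFamily} (v : Vmod)
    (hobs : ∃ H : (L.logDiagramPlus v).HomotopyFamily, L.IsLogObservablePlus v H ∧ L.CompatibleIn K H)
    {ν₂ : LogVertex (isArc v)} (ε : LogEdge (isArc v) (LogVertex.postLog (isArc v)) ν₂) (h₂ : ν₂.isPostLog = false)
    (n : ℤ) :
    ∃ k : K.E
      ((Path.nil.cons (DEdge.log n : (DVertex.row1 (n + 1) : DVertex Vmod isArc) ⟶ .row1 n)).comp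
        ((Path.nil.cons (DEdge.toCore n : (DVertex.row1 n : DVertex Vmod isArc) ⟶ .core)).comp
          (Path.nil.cons (DEdge.lam v (LogVertex.spaceLink (isArc v)) (spaceLink_isPostLog _) :
            (DVertex.core : DVertex Vmod isArc) ⟶ .nplus v))) :
        Path (DVertex.row1 (n + 1) : DVertex Vmod isArc) (DVertex.nplus v))
      ((Path.nil.cons (DEdge.toCore (n + 1) : (DVertex.row1 (n + 1) : DVertex Vmod isArc) ⟶ .core)).comp
        (Path.nil.cons (DEdge.lam v ν₂ h₂ : (DVertex.core : DVertex Vmod isArc) ⟶ .nplus v)) :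
        Path (DVertex.row1 (n + 1) : DVertex Vmod isArc) (DVertex.nplus v)),
      ∀ X₀ : L.X,
        ∃ (e₁ : (L.diagram.pathFunctor
              ((Path.nil.cons (DEdge.log n : (DVertex.row1 (n + 1) : DVertex Vmod isArc) ⟶ .row1 n)).comp
                ((Path.nil.cons (DEdge.toCore n : (DVertex.row1 n : DVertex Vmod isArc) ⟶ .core)).comp
                  (Path.nil.cons (DEdge.lam v (LogVertex.spaceLink (isArc v)) (spaceLink_isPostLog _) :
                    (DVertex.core : DVertex Vmod isArc) ⟶ .nplus v))) :
                Path (DVertex.row1 (n + 1) : DVertex Vmod isArc) (DVertex.nplus v))).obj X₀ =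
            (frobeniusTwist L.log (LogVertex.postLog (isArc v)).isPostLog ⋙ L.lam v (LogVertex.postLog (isArc v))).obj X₀)
          (e₂ : (L.lam v ν₂).obj X₀ = (L.diagram.pathFunctor
              ((Path.nil.cons (DEdge.toCore (n + 1) : (DVertex.row1 (n + 1) : DVertex Vmod isArc) ⟶ .core)).comp
                (Path.nil.cons (DEdge.lam v ν₂ h₂ : (DVertex.core : DVertex Vmod isArc) ⟶ .nplus v)) :
                Path (DVertex.row1 (n + 1) : DVertex Vmod isArc) (DVertex.nplus v))).obj X₀),
          (K.η k).app X₀ = eqToHom e₁ ≫ (L.iota v ε).app X₀ ≫ eqToHom e₂ := by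
  obtain ⟨H, hH, hcomp⟩ := hobs
  obtain ⟨hmem, hι⟩ := hH.2.2 _ ν₂ ε (by generalize isArc v = b at *; cases b <;> rfl) h₂ (spaceLink_isPostLog _) n
  obtain ⟨k, hk⟩ := hcomp _ _ hmem
  -- the embedded paths ARE the displayed paths of `Γ⃗_{D•⊢}`, and the path functors agree
  have hF₁ : (L.logDiagramPlus v).pathFunctor (postLogDomPath v n (spaceLink_isPostLog _)) =
      L.diagram.pathFunctor ((embExt (DVertex.InFirstRows 2) (.nplus v)).mapPath
        (postLogDomPath v n (spaceLink_isPostLog _))) := by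
    simp only [postLogDomPath, DiagramOfCategories.pathFunctor_cons, DiagramOfCategories.pathFunctor_nil,
      Prefunctor.mapPath_cons, Prefunctor.mapPath_nil]
    rfl
  have hF₂ : (L.logDiagramPlus v).pathFunctor (postLogCodPath v n ν₂ h₂) =
      L.diagram.pathFunctor ((embExt (DVertex.InFirstRows 2) (.nplus v)).mapPath (postLogCodPath v n ν₂ h₂)) := by
    simp only [postLogCodPath, DiagramOfCategories.pathFunctor_cons, DiagramOfCategories.pathFunctor_nil,
      Prefunctor.mapPath_cons, Prefunctor.mapPath_nil]
    rfl
  refine ⟨k, fun X₀ => ?_⟩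
  obtain ⟨hobj, hobj', hη⟩ := hι X₀
  refine ⟨(Functor.congr_obj hF₁ X₀).symm.trans hobj, hobj'.trans (Functor.congr_obj hF₂ X₀), ?_⟩
  refine (app_eq_of_heq hF₁ hF₂ hk X₀).trans ?_
  simp only [hη, Category.assoc, eqToHom_trans, eqToHom_trans_assoc]
  rfl

/-- The shift of the post-log pair at `⋎ = n` is the post-log pair at `⋎ = n + k` (left path, heterogeneously).
[cite: MochizukiAbsTopIII2015, Cor 5.5 (v) p. 132] -/
theorem mapPath_shift_postLogDom_heq (k n : ℤ) (v : Vmod) :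
    HEq ((DVertex.shiftGraph k).mapPath
        ((Path.nil.cons (DEdge.log n : (DVertex.row1 (n + 1) : DVertex Vmod isArc) ⟶ .row1 n)).comp
          ((Path.nil.cons (DEdge.toCore n : (DVertex.row1 n : DVertex Vmod isArc) ⟶ .core)).comp
            (Path.nil.cons (DEdge.lam v (LogVertex.spaceLink (isArc v)) (spaceLink_isPostLog _) :
              (DVertex.core : DVertex Vmod isArc) ⟶ .nplus v)))))
      ((Path.nil.cons (DEdge.log (n + k) : (DVertex.row1 (n + k + 1) : DVertex Vmod isArc) ⟶ .row1 (n + k))).comp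
        ((Path.nil.cons (DEdge.toCore (n + k) : (DVertex.row1 (n + k) : DVertex Vmod isArc) ⟶ .core)).comp
          (Path.nil.cons (DEdge.lam v (LogVertex.spaceLink (isArc v)) (spaceLink_isPostLog _) :
            (DVertex.core : DVertex Vmod isArc) ⟶ .nplus v))) :
        Path (DVertex.row1 (n + k + 1) : DVertex Vmod isArc) (DVertex.nplus v)) := by
  have h := Quiver.Path.toPath_comp_heq (e := DVertex.shiftHom k (DEdge.log (isArc := isArc) n))
    (e' := (DEdge.log (n + k) : (DVertex.row1 (n + k + 1) : DVertex Vmod isArc) ⟶ .row1 (n + k)))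
    (congrArg DVertex.row1 (Int.add_right_comm n 1 k)) (DVertex.shiftHom_log_heq k n)
    ((Path.nil.cons (DEdge.toCore (n + k) : (DVertex.row1 (n + k) : DVertex Vmod isArc) ⟶ .core)).cons
      (DEdge.lam v (LogVertex.spaceLink (isArc v)) (spaceLink_isPostLog _) :
        (DVertex.core : DVertex Vmod isArc) ⟶ .nplus v))
  exact h

/-- The shift of the post-log pair at `⋎ = n` is the post-log pair at `⋎ = n + k` (right path, heterogeneously).
[cite: MochizukiAbsTopIII2015, Cor 5.5 (v) p. 132] -/
theorem mapPath_shift_postLogCod_heq (k n : ℤ) (v : Vmod) (ν₂ : LogVertex (isArc v)) (h₂ : ν₂.isPostLog = false) :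
    HEq ((DVertex.shiftGraph k).mapPath
        ((Path.nil.cons (DEdge.toCore (n + 1) : (DVertex.row1 (n + 1) : DVertex Vmod isArc) ⟶ .core)).comp
          (Path.nil.cons (DEdge.lam v ν₂ h₂ : (DVertex.core : DVertex Vmod isArc) ⟶ .nplus v))))
      ((Path.nil.cons (DEdge.toCore (n + k + 1) : (DVertex.row1 (n + k + 1) : DVertex Vmod isArc) ⟶ .core)).comp
        (Path.nil.cons (DEdge.lam v ν₂ h₂ : (DVertex.core : DVertex Vmod isArc) ⟶ .nplus v)) :
        Path (DVertex.row1 (n + k + 1) : DVertex Vmod isArc) (DVertex.nplus v)) := by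
  have h := Quiver.Path.toPath_comp_heq (e := DVertex.shiftHom k (DEdge.toCore (isArc := isArc) (n + 1)))
    (e' := (DEdge.toCore (n + k + 1) : (DVertex.row1 (n + k + 1) : DVertex Vmod isArc) ⟶ .core))
    (congrArg DVertex.row1 (Int.add_right_comm n 1 k)) (DVertex.heq_toCore (Int.add_right_comm n 1 k))
    (Path.nil.cons (DEdge.lam v ν₂ h₂ : (DVertex.core : DVertex Vmod isArc) ⟶ .nplus v))
  exact h

/-- **The post-log pair of the observable is a shift-invariant pair of `K`**: its shifts are the post-log pairs at the
other `⋎`, and at every `⋎` the homotopy is pinned to the same `ι⊞_{v,ε}` (componentwise).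
[cite: MochizukiAbsTopIII2015, Cor 5.5 (v) pp. 131–133] -/
theorem shiftInvariantE_postLogPair {K : L.diagram.HomotopyFamily} (v : Vmod)
    (hobs : ∃ H : (L.logDiagramPlus v).HomotopyFamily, L.IsLogObservablePlus v H ∧ L.CompatibleIn K H)
    {ν₂ : LogVertex (isArc v)} (ε : LogEdge (isArc v) (LogVertex.postLog (isArc v)) ν₂) (h₂ : ν₂.isPostLog = false)
    (n : ℤ) :
    L.ShiftInvariantE K
      ((Path.nil.cons (DEdge.log n : (DVertex.row1 (n + 1) : DVertex Vmod isArc) ⟶ .row1 n)).comp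
        ((Path.nil.cons (DEdge.toCore n : (DVertex.row1 n : DVertex Vmod isArc) ⟶ .core)).comp
          (Path.nil.cons (DEdge.lam v (LogVertex.spaceLink (isArc v)) (spaceLink_isPostLog _) :
            (DVertex.core : DVertex Vmod isArc) ⟶ .nplus v))))
      ((Path.nil.cons (DEdge.toCore (n + 1) : (DVertex.row1 (n + 1) : DVertex Vmod isArc) ⟶ .core)).comp
        (Path.nil.cons (DEdge.lam v ν₂ h₂ : (DVertex.core : DVertex Vmod isArc) ⟶ .nplus v))) := by
  obtain ⟨k₀, e₀⟩ := L.exists_η_postLogPair_eq_iota v hobs ε h₂ n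
  refine ⟨k₀, fun k => ?_⟩
  obtain ⟨k₁, e₁⟩ := L.exists_η_postLogPair_eq_iota v hobs ε h₂ (n + k)
  have ha : (DVertex.shiftGraph k).obj (DVertex.row1 (n + 1) : DVertex Vmod isArc) = DVertex.row1 (n + k + 1) :=
    congrArg DVertex.row1 (Int.add_right_comm n 1 k)
  refine ⟨(K.E_iff_of_heq ha rfl (mapPath_shift_postLogDom_heq k n v) (mapPath_shift_postLogCod_heq k n v ν₂ h₂)).mpr k₁,
    fun h₀ y y' hy => ?_⟩
  -- `y`, `y'` are objects of `𝒳`; compare both sides with `ι⊞_{v,ε}` at that object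
  obtain rfl : y' = y := eq_of_heq hy
  refine (K.η_app_heq_of_heq ha rfl (mapPath_shift_postLogDom_heq k n v) (mapPath_shift_postLogCod_heq k n v ν₂ h₂) _ k₁
    (HEq.refl y')).trans ?_
  obtain ⟨a₁, b₁, E₁⟩ := e₁ y'
  obtain ⟨a₀, b₀, E₀⟩ := e₀ y'
  exact (heq_of_eq E₁).trans (((eqToHom_comp_comp_eqToHom_heq_of_heq a₁ b₁ _ HEq.rfl).trans
    (eqToHom_comp_comp_eqToHom_heq_of_heq a₀ b₀ _ HEq.rfl).symm).trans (heq_of_eq E₀.symm))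

end LogFrobeniusSetting

end Literature.AnabelianGeometry.AbsoluteAnabelian
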